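import Summits.CriticalPhenomena.CardyFormulaZ2.Theses.CardyIsoradial
import Literature.Probability.Percolation.IsoradialSquareLatticeGMTiling
import Literature.Probability.Percolation.IsoradialRectangularCrossings
import Literature.Probability.RandomPlanarGeometry.ZoomFlow

/-!
# `lindef_modulus` vs `birth` — the two coupling stubs of the ALT line are WEAKER than birth's

Kernel-checked comparison for crux stmt-CriticalPhenomena-0785 (`CrossingLimitInvariance`). The five stub
STATEMENTS are restated verbatim as `def`s (neither skeleton is imported, so no `sorry` is in scope):
`Birth_A/B/C` = `Lines/birth.lean`'s `stub_gridReduction / stub_squareGridUniversality / stub_quadToCrude`,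
`Lindef_L1a/L1b` = `Lines/lindef_modulus.lean`'s `stub_gridLinear / stub_hubLinear`. Proved below:
`Birth_A → Lindef_L1a` (take `M₁ = id`) and `Birth_B → Birth_C → Lindef_L1b` (take `M₂ = id`, second hub
`ℤ² = G_{-π/4,π/4}` by the tree theorem `gmEmbedding_squareLattice`). Hence the only content of
`lindef_modulus` beyond `birth` is its third stub `stub_modulus` (rigidity of the modulus), while each of
birth's A, B contains in addition a zero-drift statement that `lindef_modulus` defers to `stub_modulus`.
-/

noncomputable section

namespace Summit.CriticalPhenomena.CardyFormulaZ2.Cruxes.CrossingLimitInvariance.LindefVsBirth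

open Filter Topology Set
open Literature.Probability.RandomPlanarGeometry (ConformalRectangle MarkedDomain.map_refl)

/-- birth's `stub_gridReduction` (verbatim). -/
def Birth_A : Prop :=
    ∀ (V F : Type) [Countable V] [DecidableEq V] [DecidableEq F] (G : SimpleGraph V) [G.LocallyFinite]
      (emb : Literature.Probability.LatticeModels.RhombicEmbedding G F),
      G.Preconnected → emb.IsIsoradial → emb.IsRhombicTiling → emb.HasSquareGridProperty →
      ∀ ε : ℝ, 0 < ε → emb.HasBoundedAngles ε →
      ∃ (α β : ℤ → ℝ) (ε' : ℝ), 0 < ε' ∧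
        (∀ i j : ℤ, 2 * ε' ≤ β j - α i ∧ β j - α i ≤ Real.pi - 2 * ε') ∧
        ∀ R : Literature.Probability.RandomPlanarGeometry.ConformalRectangle,
          Tendsto
            (fun δ : ℝ =>
              emb.isoradialPercolation.real
                  (Literature.Probability.Percolation.embDomainCrossing emb.z R.carrier δ (R.arc 0)
                    (R.arc 2)) -
                (Literature.Probability.Percolation.gmEmbedding α β).isoradialPercolation.real
                  (Literature.Probability.Percolation.embDomainCrossing
                    (Literature.Probability.Percolation.gmEmbedding α β).z R.carrier δ (R.arc 0)
                    (R.arc 2)))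
            (𝓝[>] (0 : ℝ)) (𝓝 (0 : ℝ))

/-- birth's `stub_squareGridUniversality` (verbatim). -/
def Birth_B : Prop :=
    ∀ (α β : ℤ → ℝ) (ε : ℝ), 0 < ε →
      (∀ i j : ℤ, 2 * ε ≤ β j - α i ∧ β j - α i ≤ Real.pi - 2 * ε) →
      ∀ (α' β' : ℤ → ℝ) (ε' : ℝ), 0 < ε' →
      (∀ i j : ℤ, 2 * ε' ≤ β' j - α' i ∧ β' j - α' i ≤ Real.pi - 2 * ε') →
      ∀ R : Literature.Probability.RandomPlanarGeometry.ConformalRectangle,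
        Tendsto
          (fun δ : ℝ =>
            (Literature.Probability.Percolation.gmEmbedding α β).isoradialPercolation.real
                (Literature.Probability.Percolation.quadCrossingEmb
                  (Literature.Probability.Percolation.gmEmbedding α β).z R δ) -
              (Literature.Probability.Percolation.gmEmbedding α' β').isoradialPercolation.real
                (Literature.Probability.Percolation.quadCrossingEmb
                  (Literature.Probability.Percolation.gmEmbedding α' β').z R δ))
          (𝓝[>] (0 : ℝ)) (𝓝 (0 : ℝ))

/-- birth's `stub_quadToCrude` (verbatim). -/
def Birth_C : Prop :=
    ∀ (α β : ℤ → ℝ) (ε : ℝ), 0 < ε →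
      (∀ i j : ℤ, 2 * ε ≤ β j - α i ∧ β j - α i ≤ Real.pi - 2 * ε) →
      ∀ R : Literature.Probability.RandomPlanarGeometry.ConformalRectangle,
        Tendsto
          (fun δ : ℝ =>
            (Literature.Probability.Percolation.gmEmbedding α β).isoradialPercolation.real
                (Literature.Probability.Percolation.quadCrossingEmb
                  (Literature.Probability.Percolation.gmEmbedding α β).z R δ) -
              (Literature.Probability.Percolation.gmEmbedding α β).isoradialPercolation.real
                (Literature.Probability.Percolation.embDomainCrossing
                  (Literature.Probability.Percolation.gmEmbedding α β).z R.carrier δ (R.arc 0)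
                  (R.arc 2)))
          (𝓝[>] (0 : ℝ)) (𝓝 (0 : ℝ))

/-- lindef_modulus's `stub_gridLinear` (verbatim). -/
def Lindef_L1a : Prop :=
    ∀ (V F : Type) [Countable V] [DecidableEq V] [DecidableEq F] (G : SimpleGraph V) [G.LocallyFinite]
      (emb : Literature.Probability.LatticeModels.RhombicEmbedding G F),
      G.Preconnected → emb.IsIsoradial → emb.IsRhombicTiling → emb.HasSquareGridProperty →
      ∀ ε : ℝ, 0 < ε → emb.HasBoundedAngles ε →
      ∃ (α β : ℤ → ℝ) (ε' : ℝ), 0 < ε' ∧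
        (∀ i j : ℤ, 2 * ε' ≤ β j - α i ∧ β j - α i ≤ Real.pi - 2 * ε') ∧
        ∃ M₁ : ℂ ≃L[ℝ] ℂ, 0 < LinearMap.det (M₁.toLinearEquiv : ℂ →ₗ[ℝ] ℂ) ∧
          ∀ R : Literature.Probability.RandomPlanarGeometry.ConformalRectangle,
            Filter.Tendsto
              (fun δ : ℝ =>
                emb.isoradialPercolation.real
                    (Literature.Probability.Percolation.embDomainCrossing emb.z R.carrier δ (R.arc 0)
                      (R.arc 2)) -
                  (Literature.Probability.Percolation.gmEmbedding α β).isoradialPercolation.real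
                    (Literature.Probability.Percolation.embDomainCrossing
                      (Literature.Probability.Percolation.gmEmbedding α β).z
                      (Literature.Probability.RandomPlanarGeometry.MarkedDomain.map R M₁.toHomeomorph).carrier
                      δ
                      ((Literature.Probability.RandomPlanarGeometry.MarkedDomain.map R M₁.toHomeomorph).arc 0)
                      ((Literature.Probability.RandomPlanarGeometry.MarkedDomain.map R M₁.toHomeomorph).arc 2)))
              (nhdsWithin (0 : ℝ) (Set.Ioi 0)) (nhds (0 : ℝ))

/-- lindef_modulus's `stub_hubLinear` (verbatim). -/
def Lindef_L1b : Prop :=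
    ∀ (α β : ℤ → ℝ) (ε' : ℝ), 0 < ε' →
      (∀ i j : ℤ, 2 * ε' ≤ β j - α i ∧ β j - α i ≤ Real.pi - 2 * ε') →
      ∃ M₂ : ℂ ≃L[ℝ] ℂ, 0 < LinearMap.det (M₂.toLinearEquiv : ℂ →ₗ[ℝ] ℂ) ∧
        ∀ R : Literature.Probability.RandomPlanarGeometry.ConformalRectangle,
          Filter.Tendsto
            (fun δ : ℝ =>
              (Literature.Probability.Percolation.gmEmbedding α β).isoradialPercolation.real
                  (Literature.Probability.Percolation.embDomainCrossing
                    (Literature.Probability.Percolation.gmEmbedding α β).z R.carrier δ (R.arc 0) (R.arc 2)) -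
                Literature.Probability.LatticeModels.squareLatticeEmbedding.isoradialPercolation.real
                  (Literature.Probability.Percolation.embDomainCrossing
                    Literature.Probability.LatticeModels.squareLatticeEmbedding.z
                    (Literature.Probability.RandomPlanarGeometry.MarkedDomain.map R M₂.toHomeomorph).carrier δ
                    ((Literature.Probability.RandomPlanarGeometry.MarkedDomain.map R M₂.toHomeomorph).arc 0)
                    ((Literature.Probability.RandomPlanarGeometry.MarkedDomain.map R M₂.toHomeomorph).arc 2)))
            (nhdsWithin (0 : ℝ) (Set.Ioi 0)) (nhds (0 : ℝ))

/-- The identity of `ℂ` as a real-continuous-linear automorphism has positive determinant. [folklore] -/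
theorem det_refl_pos : 0 < LinearMap.det ((ContinuousLinearEquiv.refl ℝ ℂ).toLinearEquiv : ℂ →ₗ[ℝ] ℂ) := by
  have : ((ContinuousLinearEquiv.refl ℝ ℂ).toLinearEquiv : ℂ →ₗ[ℝ] ℂ) = LinearMap.id := by
    ext z
    simp
  rw [this, LinearMap.det_id]
  exact one_pos

/-- Mapping a marked domain by the identity automorphism does nothing. [folklore] -/
theorem map_refl_toHomeomorph (R : ConformalRectangle) :
    R.map (ContinuousLinearEquiv.refl ℝ ℂ).toHomeomorph = R := by
  have : (ContinuousLinearEquiv.refl ℝ ℂ).toHomeomorph = Homeomorph.refl ℂ := by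
    ext z
    rfl
  rw [this]
  exact MarkedDomain.map_refl R

/-- **birth A ⇒ lindef L1a.** [folklore] -/
theorem l1a_of_birthA (hA : Birth_A) : Lindef_L1a := by
  intro V F _ _ _ G _ emb hpre hiso htile hsgp ε hε hbap
  obtain ⟨α, β, ε', hε', hang, h⟩ := hA V F G emb hpre hiso htile hsgp ε hε hbap
  refine ⟨α, β, ε', hε', hang, ContinuousLinearEquiv.refl ℝ ℂ, det_refl_pos, fun R => ?_⟩
  rw [map_refl_toHomeomorph]
  exact h R

/-- **birth B + birth C ⇒ lindef L1b.** [folklore] -/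
theorem l1b_of_birthBC (hB : Birth_B) (hC : Birth_C) : Lindef_L1b := by
  intro α β ε' hε' hang
  refine ⟨ContinuousLinearEquiv.refl ℝ ℂ, det_refl_pos, fun R => ?_⟩
  rw [map_refl_toHomeomorph]
  have hq : 0 < Real.pi / 4 := by positivity
  have hangZ : ∀ i j : ℤ, 2 * (Real.pi / 4) ≤ (fun _ : ℤ => Real.pi / 4) j - (fun _ : ℤ => -(Real.pi / 4)) i ∧
      (fun _ : ℤ => Real.pi / 4) j - (fun _ : ℤ => -(Real.pi / 4)) i ≤ Real.pi - 2 * (Real.pi / 4) := by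
    intro i j
    simp only
    constructor <;> linarith [Real.pi_pos]
  have h1 := hC α β ε' hε' hang R
  have h2 := hB α β ε' hε' hang _ _ _ hq hangZ R
  have h3 := hC _ _ _ hq hangZ R
  have key := (h2.sub h1).add h3
  rw [sub_zero, add_zero] at key
  rw [← Literature.Probability.Percolation.gmEmbedding_squareLattice]
  refine key.congr' (Eventually.of_forall fun δ => ?_)
  ring

end Summit.CriticalPhenomena.CardyFormulaZ2.Cruxes.CrossingLimitInvariance.LindefVsBirth

end
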